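import Summits.Ventures.CertifiedManyBodySolver.Observables.StructureFactors

/-!
# M3 observables (iii), positivity: `𝓢_s(q) ⪰ 0`, `𝓢_c(q) ⪰ 0` — the a-priori edge `0 ≤ S(q; ψ)`

HONEST FRAMING: first certified bounds; not a superconductivity verdict; every number
certified or labelled float.  This file contains exact operator IDENTITIES and their immediate
consequence `0 ≤ S_s(q; ψ)`, `0 ≤ S_c(q; ψ)` for EVERY vector `ψ` — kinematics, no bound on any
Hubbard ground state is claimed here.

Companion of `Observables/StructureFactors.lean` (speedrun `mbsolver`, request M3-L1, seat
sr-mbsolver-m3-7).  The one-sided structure-factor rows of M3.md §4 are printed as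
`[⟨a-priori edge⟩, U]`; this file supplies the a-priori edge `0` in Lean:

* `spinWavePlus/Minus/Z L k = T^{±,z}(q) = Σ_x e^{iq·x} S^{±,z}_x`, `densityWave L k = ρ(q) = Σ_x e^{iq·x} n_x`;
* `spinStructureOp_eq_waves`: **`𝓢_s(q) = ½ (T⁺(q) T⁺(q)ᴴ + T⁻(q) T⁻(q)ᴴ) + Tᶻ(q) Tᶻ(q)ᴴ`**;
  `densityStructureOp_eq_waves`: **`𝓢_c(q) = ρ(q) ρ(q)ᴴ`** (Gram operators);
* `spinStructureFactor_nonneg`: `0 ≤ S_s(q; ψ)`; `densityStructureFactor_nonneg`: `0 ≤ S_c(q; ψ)`.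
Hirsch, PRB 31 (1985) 4403, eq. (4.7) (structure factors as `⟨ρ_q ρ_{-q}⟩`).
-/

noncomputable section

namespace Summit.Ventures.CertifiedManyBodySolver.Observables

open Matrix Literature.MathematicalPhysics.QuantumLattice Literature.Probability.LatticeModels
open Literature.MathematicalPhysics.QuantumLattice.HubbardWave0
open Literature.MathematicalPhysics.QuantumLattice.FermionTorus
open scoped BigOperators ComplexConjugate

/-! ## Positivity: `𝓢_s(q) = ½(T⁺T⁺ᴴ + T⁻T⁻ᴴ) + TᶻTᶻᴴ ⪰ 0`, `𝓢_c(q) = ρ_q ρ_qᴴ ⪰ 0` — the a-priori edge `0 ≤ S(q; ψ)` -/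

section Positivity

open scoped ComplexOrder

variable (L : ℕ) [NeZero L]

/-- **Spin-density-wave operator** `T⁺(q) = Σ_x e^{iq·x} S⁺_x`. -/
def spinWavePlus (k : TorusSite 2 L) : Matrix (Finset (Orb (FermionTorus 2 L))) (Finset (Orb (FermionTorus 2 L))) ℂ :=
  ∑ x : TorusSite 2 L, blochPhase L k x • fermionSpinPlus (ofTorusSite x)

/-- `T⁻(q) = Σ_x e^{iq·x} S⁻_x`. -/
def spinWaveMinus (k : TorusSite 2 L) : Matrix (Finset (Orb (FermionTorus 2 L))) (Finset (Orb (FermionTorus 2 L))) ℂ :=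
  ∑ x : TorusSite 2 L, blochPhase L k x • fermionSpinMinus (ofTorusSite x)

/-- `Tᶻ(q) = Σ_x e^{iq·x} Sᶻ_x`. -/
def spinWaveZ (k : TorusSite 2 L) : Matrix (Finset (Orb (FermionTorus 2 L))) (Finset (Orb (FermionTorus 2 L))) ℂ :=
  ∑ x : TorusSite 2 L, blochPhase L k x • fermionSpinZ (ofTorusSite x)

/-- **Density-wave operator** `ρ(q) = Σ_x e^{iq·x} n_x`. -/
def densityWave (k : TorusSite 2 L) : Matrix (Finset (Orb (FermionTorus 2 L))) (Finset (Orb (FermionTorus 2 L))) ℂ :=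
  ∑ x : TorusSite 2 L, blochPhase L k x • siteDensity (ofTorusSite x)

/-- `T⁺(q)ᴴ = Σ_y e^{-iq·y} S⁻_y`. -/
theorem conjTranspose_spinWavePlus (k : TorusSite 2 L) :
    (spinWavePlus L k)ᴴ = ∑ y : TorusSite 2 L, star (blochPhase L k y) • fermionSpinMinus (ofTorusSite y) := by
  simp only [spinWavePlus, Matrix.conjTranspose_sum, Matrix.conjTranspose_smul, conjTranspose_fermionSpinPlus]

/-- `T⁻(q)ᴴ = Σ_y e^{-iq·y} S⁺_y`. -/
theorem conjTranspose_spinWaveMinus (k : TorusSite 2 L) :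
    (spinWaveMinus L k)ᴴ = ∑ y : TorusSite 2 L, star (blochPhase L k y) • fermionSpinPlus (ofTorusSite y) := by
  simp only [spinWaveMinus, Matrix.conjTranspose_sum, Matrix.conjTranspose_smul, conjTranspose_fermionSpinMinus]

/-- `Tᶻ(q)ᴴ = Σ_y e^{-iq·y} Sᶻ_y`. -/
theorem conjTranspose_spinWaveZ (k : TorusSite 2 L) :
    (spinWaveZ L k)ᴴ = ∑ y : TorusSite 2 L, star (blochPhase L k y) • fermionSpinZ (ofTorusSite y) := by
  simp only [spinWaveZ, Matrix.conjTranspose_sum, Matrix.conjTranspose_smul, conjTranspose_fermionSpinZ]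

/-- `ρ(q)ᴴ = Σ_y e^{-iq·y} n_y`. -/
theorem conjTranspose_densityWave (k : TorusSite 2 L) :
    (densityWave L k)ᴴ = ∑ y : TorusSite 2 L, star (blochPhase L k y) • siteDensity (ofTorusSite y) := by
  simp only [densityWave, Matrix.conjTranspose_sum, Matrix.conjTranspose_smul, conjTranspose_siteDensity]

/-- **`𝓢_s(q) = ½ (T⁺(q) T⁺(q)ᴴ + T⁻(q) T⁻(q)ᴴ) + Tᶻ(q) Tᶻ(q)ᴴ`**: the spin structure-factor operator is a
sum of Gram operators. Hirsch 1985 eq. (4.7). -/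
theorem spinStructureOp_eq_waves (k : TorusSite 2 L) :
    spinStructureOp L k =
      (1 / 2 : ℂ) • (spinWavePlus L k * (spinWavePlus L k)ᴴ + spinWaveMinus L k * (spinWaveMinus L k)ᴴ) +
        spinWaveZ L k * (spinWaveZ L k)ᴴ := by
  rw [conjTranspose_spinWavePlus, conjTranspose_spinWaveMinus, conjTranspose_spinWaveZ, spinWavePlus,
    spinWaveMinus, spinWaveZ, Finset.sum_mul_sum, Finset.sum_mul_sum, Finset.sum_mul_sum,
    ← Finset.sum_add_distrib, Finset.smul_sum, ← Finset.sum_add_distrib, spinStructureOp]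
  refine Finset.sum_congr rfl fun x _ => ?_
  rw [← Finset.sum_add_distrib, Finset.smul_sum, ← Finset.sum_add_distrib]
  refine Finset.sum_congr rfl fun y _ => ?_
  rw [fermionSpinDot_def]
  simp only [smul_mul_smul_comm, smul_add, smul_smul]
  ring_nf

/-- **`𝓢_c(q) = ρ(q) ρ(q)ᴴ`**. -/
theorem densityStructureOp_eq_waves (k : TorusSite 2 L) :
    densityStructureOp L k = densityWave L k * (densityWave L k)ᴴ := by
  rw [conjTranspose_densityWave, densityWave, Finset.sum_mul_sum, densityStructureOp]
  refine Finset.sum_congr rfl fun x _ => Finset.sum_congr rfl fun y _ => ?_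
  rw [smul_mul_smul_comm]

omit [NeZero L] in
/-- `Re ⟨ψ, A Aᴴ ψ⟩ = ‖Aᴴψ‖² ≥ 0`. -/
private theorem re_expect_mul_conjTranspose_nonneg
    (A : Matrix (Finset (Orb (FermionTorus 2 L))) (Finset (Orb (FermionTorus 2 L))) ℂ)
    (ψ : Fock (Orb (FermionTorus 2 L))) : 0 ≤ (expect (A * Aᴴ) ψ).re := by
  have h := (Matrix.posSemidef_self_mul_conjTranspose A).dotProduct_mulVec_nonneg ψ
  exact (Complex.nonneg_iff.mp h).1

/-- **`0 ≤ S_s(q; ψ)`** for every `q` and every vector `ψ` — the a-priori lower edge of the one-sided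
`Ss.q*` rows. -/
theorem spinStructureFactor_nonneg (k : TorusSite 2 L) (ψ : Fock (Orb (FermionTorus 2 L))) :
    0 ≤ spinStructureFactor L k ψ := by
  have ha := re_expect_mul_conjTranspose_nonneg L (spinWavePlus L k) ψ
  have hb := re_expect_mul_conjTranspose_nonneg L (spinWaveMinus L k) ψ
  have hc := re_expect_mul_conjTranspose_nonneg L (spinWaveZ L k) ψ
  have hhalf : (1 / 2 : ℂ) = ((1 / 2 : ℝ) : ℂ) := by norm_num
  have hre : (expect (spinStructureOp L k) ψ).re =
      (1 / 2 : ℝ) * ((expect (spinWavePlus L k * (spinWavePlus L k)ᴴ) ψ).re +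
          (expect (spinWaveMinus L k * (spinWaveMinus L k)ᴴ) ψ).re) +
        (expect (spinWaveZ L k * (spinWaveZ L k)ᴴ) ψ).re := by
    rw [spinStructureOp_eq_waves, expect_add, expect_smul, expect_add, Complex.add_re, hhalf,
      Complex.re_ofReal_mul, Complex.add_re]
  have hnum : 0 ≤ (expect (spinStructureOp L k) ψ).re := by
    rw [hre]
    nlinarith [ha, hb, hc]
  exact div_nonneg hnum (pow_nonneg (Nat.cast_nonneg L) 2)

/-- **`0 ≤ S_c(q; ψ)`** for every `q` and every vector `ψ`. -/
theorem densityStructureFactor_nonneg (k : TorusSite 2 L) (ψ : Fock (Orb (FermionTorus 2 L))) :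
    0 ≤ densityStructureFactor L k ψ := by
  have hnum : 0 ≤ (expect (densityStructureOp L k) ψ).re := by
    rw [densityStructureOp_eq_waves]
    exact re_expect_mul_conjTranspose_nonneg L (densityWave L k) ψ
  exact div_nonneg hnum (pow_nonneg (Nat.cast_nonneg L) 2)

end Positivity

end Summit.Ventures.CertifiedManyBodySolver.Observables
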